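import Mathlib
import Literature.NumberTheory.Automorphic.HilbertModularFormQExpansion
import Literature.Analysis.Complex.OsgoodProofs

/-!
# Holomorphic functions on the tube domain `ℍ` have no zero divisors

Stub N2 (`stub_hol_noZeroDivisors`) of line Sketch-ideate-r1-k1 for the crux
`HilbertIntegralOverconvergentIsCongruence` (stmt-Langlands-8485).  Section N of the line runs the
abstract "algebraic over the ring of Hilbert modular forms ⇒ modular" transfer on the ring of
holomorphic functions on `ℍ = halfSpace F ⊆ Point F = ℂ^{Hom(F,ℝ)}`, which must be a domain: if
`f g = 0` on `ℍ` and `f` is not identically zero, then `g = 0` on `ℍ`.  Proof: `ℍ` is open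
(`isOpen_halfSpace`) and convex (a product of open upper half planes), hence preconnected; by
Osgood's lemma (`Literature.Analysis.Complex.osgoodLemma_holds`) the holomorphic `g` is analytic on
`ℍ`; near a point `z₀ ∈ ℍ` with `f z₀ ≠ 0` continuity keeps `f ≠ 0`, so `g = 0` there, and the
identity principle (`AnalyticOnNhd.eqOn_zero_of_preconnected_of_eventuallyEq_zero`) gives `g = 0`
on all of `ℍ`.
-/

set_option linter.dupNamespace false

noncomputable section

namespace Summit.Langlands.Langlands.Theorems.HilbertIntegralOverconvergentIsCongruence

open MeasureTheory Complex NumberField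
open Literature.NumberTheory.Automorphic Literature.NumberTheory.Automorphic.HilbertModular

variable {F : Type} [Field F] [NumberField F]

omit [NumberField F] in
/-- `ℍ` is convex: it is the product over the real embeddings of the open upper half planes
`{w : ℂ | 0 < Im w}`, each of which is convex. -/
theorem nzd_convex_halfSpace : Convex ℝ (halfSpace F) := by
  have : halfSpace F = Set.pi Set.univ fun _ : F →+* ℝ ↦ {w : ℂ | 0 < w.im} := by
    ext z; simp [mem_halfSpace_iff]
  rw [this]
  exact convex_pi fun _ _ ↦ convex_halfSpace_im_gt 0

omit [NumberField F] in
/-- `ℍ` is preconnected (it is convex). -/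
theorem nzd_isPreconnected_halfSpace : IsPreconnected (halfSpace F) :=
  nzd_convex_halfSpace.isPreconnected

/-- A function holomorphic on `ℍ` is analytic on `ℍ` (Osgood's lemma for the open subset `ℍ` of the
finite-dimensional complex normed space `ℂ^{Hom(F,ℝ)}`). -/
theorem nzd_analyticOnNhd_of_isHolomorphicOn {f : Point F → ℂ} (hf : IsHolomorphicOn F f) :
    AnalyticOnNhd ℂ f (halfSpace F) :=
  Literature.Analysis.Complex.osgoodLemma_holds (Point F) isOpen_halfSpace hf

/-- **stub N2 — `stub_hol_noZeroDivisors`.** The ring of holomorphic functions on `ℍ` has no zero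
divisors: if `f g = 0` on `ℍ` and `f z₀ ≠ 0` for some `z₀ ∈ ℍ`, then `g = 0` on `ℍ` (by continuity
`f ≠ 0`, hence `g = 0`, on a neighbourhood of `z₀`; `g` is analytic on the preconnected open set `ℍ`
by Osgood's lemma, so the identity principle gives `g = 0` on `ℍ`). [folklore] -/
theorem stub_hol_noZeroDivisors (F : Type) [Field F] [NumberField F] (f g : Point F → ℂ)
    (hf : IsHolomorphicOn F f) (hg : IsHolomorphicOn F g) (hfg : ∀ z ∈ halfSpace F, f z * g z = 0)
    (hf0 : ∃ z ∈ halfSpace F, f z ≠ 0) : ∀ z ∈ halfSpace F, g z = 0 := by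
  obtain ⟨z₀, hz₀, hfz₀⟩ := hf0
  -- `f ≠ 0`, hence `g = 0`, on a neighbourhood of `z₀` inside the open set `ℍ`
  have hcont : ContinuousAt f z₀ :=
    (hf.continuousOn z₀ hz₀).continuousAt (isOpen_halfSpace.mem_nhds hz₀)
  have hne : ∀ᶠ z in nhds z₀, f z ≠ 0 := hcont.eventually_ne hfz₀
  have hmem : ∀ᶠ z in nhds z₀, z ∈ halfSpace F := isOpen_halfSpace.mem_nhds hz₀
  have hg0 : g =ᶠ[nhds z₀] 0 := by
    filter_upwards [hne, hmem] with z hz hzU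
    exact (mul_eq_zero.mp (hfg z hzU)).resolve_left hz
  -- identity principle on the preconnected set `ℍ` for the analytic `g`
  have hzero : Set.EqOn g 0 (halfSpace F) :=
    (nzd_analyticOnNhd_of_isHolomorphicOn hg).eqOn_zero_of_preconnected_of_eventuallyEq_zero
      nzd_isPreconnected_halfSpace hz₀ hg0
  intro z hz
  exact hzero hz

end Summit.Langlands.Langlands.Theorems.HilbertIntegralOverconvergentIsCongruence
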